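import Literature.Probability.LatticeModels.LatticeGraph
import Mathlib.Algebra.CharP.Two
import Mathlib.Data.ZMod.Basic
import Mathlib.Algebra.BigOperators.Fin
import HarnessLib

/-!
# `𝔽₂` edge chains on the discrete 2-torus: degrees, cuts, and generation of the cycle space by
# plaquettes and two fundamental cycles

Topic `Probability/LatticeModels` (companion of `LatticeGraph`: `TorusSite`, `torusGraph`). The
combinatorial-topological input of the Peierls argument on the torus `(ℤ/Lℤ)²` (Fröhlich–Lieb 1978
Thm. 1.1: "well known combinatorics … all contours consist of one or two closed pieces … each
contour must separate `m` from `n`"), done graph-theoretically after Timár (*Boundary-connectivity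
via graph theory*, Lemma 1: a minimal cutset cannot be split into two parts unless some cycle of a
GENERATING family of cycles meets both — "addition is always understood modulo 2, and this is how
we define the sums of sets of edges (regarded as vectors over the 2-element field), in particular,
this defines the generation of cycles by other cycles").

Edges of the torus graph are keyed by `(x, k)`, `x ∈ (ℤ/Lℤ)²`, `k ∈ {0,1}` = the edge
`{x, x + e_k}` (a bijection onto the edge set for `L ≥ 3`); an `𝔽₂`-chain is a function
`f : (ℤ/Lℤ)² → Fin 2 → ZMod 2`.

* `chainDeg f x` — the mod-2 degree of `f` at `x`; `singleChain`, `plaqChain y` (the 4-cycle with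
  lower-left corner `y`), `rowChain r` (the horizontal cycle `x₁ = r`), `colChain c` (the vertical
  cycle `x₀ = c`), `plaqSpan a = Σ_y a_y · plaq_y`; their degrees vanish;
* `pairKeys f Γ = Σ_{e ∈ Γ} f e` — the `𝔽₂` pairing with a finite key set; `cutKeys A` — the keys of
  the edge boundary of a site set `A`; `pairKeys_plaqChain_cutKeys`, `pairKeys_rowChain_cutKeys`,
  `pairKeys_colChain_cutKeys` — every plaquette / fundamental cycle crosses every cut an even number
  of times;
* **`exists_eq_plaqSpan_add`** — GENERATION: every chain with all degrees even is
  `plaqSpan a + ε₀ · rowChain r₀ + ε₁ · colChain c₀` for ANY prescribed row `r₀` and column `c₀`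
  (`L ≥ 2`; explicit potentials by cyclic cumulative sums) — the cycle space of the torus graph is
  spanned by the plaquettes and two fundamental cycles (first homology of the torus).

Pure finite combinatorics/linear algebra over `𝔽₂`; no named facts, no sorries.

## References

* Á. Timár, *Boundary-connectivity via graph theory*, Proc. Amer. Math. Soc. **141** (2013)
  475–480, Lemma 1 and §1 (sums of edge sets mod 2; generating families of cycles). [Timar2012]
* J. Fröhlich, E. H. Lieb, Comm. Math. Phys. **60** (1978) 233–267, §I.C Thm. 1.1.
  [FrohlichLieb1978]
* S. Friedli, Y. Velenik, *Statistical Mechanics of Lattice Systems*, CUP 2017, §3.1 (the torus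
  `(ℤ/Lℤ)^d`), §3.7.2 (contours as edge boundaries). [FriedliVelenik2017]
-/

noncomputable section

open Finset
open scoped BigOperators

namespace Literature.Probability.LatticeModels

/-! ### Arithmetic in `ZMod 2` and along `ZMod L` -/

section ZModAux

/-- `u + u = 0` in `𝔽₂`. [folklore] -/
private theorem tec_z2_add_self : ∀ u : ZMod 2, u + u = 0 := by decide

/-- `u + v = 0 ↔ u = v` in `𝔽₂`. [folklore] -/
private theorem tec_z2_add_eq_zero_iff : ∀ u v : ZMod 2, u + v = 0 ↔ u = v := by decide

/-- `-u = u` in `𝔽₂`. [folklore] -/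
private theorem tec_z2_neg : ∀ u : ZMod 2, -u = u := by decide

variable {L : ℕ} [NeZero L]

/-- `val (w + 1) = val w + 1` unless `w + 1 = 0`. [folklore] -/
private theorem tec_val_add_one {w : ZMod L} (hL : 1 < L) (h : w + 1 ≠ 0) :
    (w + 1).val = w.val + 1 := by
  haveI : Fact (1 < L) := ⟨hL⟩
  have hlt : w.val < L := ZMod.val_lt w
  rw [ZMod.val_add, ZMod.val_one]
  rcases Nat.lt_or_ge (w.val + 1) L with h1 | h1
  · exact Nat.mod_eq_of_lt h1
  · exfalso
    have hL' : w.val + 1 = L := le_antisymm hlt h1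
    apply h
    rw [← ZMod.val_eq_zero, ZMod.val_add, ZMod.val_one, hL', Nat.mod_self]

omit [NeZero L] in
/-- A natural number below `L` that vanishes in `ZMod L` is `0`. [folklore] -/
private theorem tec_natCast_eq_zero {n : ℕ} (hn : n < L) (h : (n : ZMod L) = 0) : n = 0 := by
  have := congrArg ZMod.val h
  rwa [ZMod.val_natCast, Nat.mod_eq_of_lt hn, ZMod.val_zero] at this

/-- `z = b + val (z - b)`. [folklore] -/
private theorem tec_eq_base_add_val (b z : ZMod L) : z = b + ((z - b).val : ℕ) := by
  rw [ZMod.natCast_zmod_val, add_sub_cancel]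

/-- **Cyclic cumulative sum** of `g : ZMod L → ZMod 2` from the base point `b` (exclusive) up to `z`
(inclusive), going in the `+1` direction: `Σ_{t=1}^{val(z-b)} g (b + t)`. [folklore] -/
def cycCum (g : ZMod L → ZMod 2) (b z : ZMod L) : ZMod 2 :=
  ∑ t ∈ range (z - b).val, g (b + ((t + 1 : ℕ) : ZMod L))

omit [NeZero L] in
/-- `cycCum` is additive in the summand. [folklore] -/
private theorem tec_cycCum_add (g g' : ZMod L → ZMod 2) (b z : ZMod L) :
    cycCum (g + g') b z = cycCum g b z + cycCum g' b z := by
  simp only [cycCum, Pi.add_apply, sum_add_distrib]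

omit [NeZero L] in
/-- The empty cumulative sum. [folklore] -/
private theorem tec_cycCum_self (g : ZMod L → ZMod 2) (b : ZMod L) : cycCum g b b = 0 := by
  simp [cycCum]

/-- One more step: `cycCum g b (z + 1) = cycCum g b z + g (z + 1)` unless `z + 1 = b`. [folklore] -/
private theorem tec_cycCum_add_one (hL : 1 < L) (g : ZMod L → ZMod 2) {b z : ZMod L} (h : z + 1 ≠ b) :
    cycCum g b (z + 1) = cycCum g b z + g (z + 1) := by
  have h' : z - b + 1 ≠ 0 := by
    intro h0; apply h
    have := congrArg (· + b) h0
    simpa [sub_add_cancel, add_right_comm] using this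
  have hval : (z + 1 - b).val = (z - b).val + 1 := by
    rw [show z + 1 - b = z - b + 1 by ring, tec_val_add_one hL h']
  rw [cycCum, hval, sum_range_succ, ← cycCum]
  congr 1
  rw [Nat.cast_add, Nat.cast_one, ZMod.natCast_zmod_val]
  congr 1; ring

/-- Telescoping: `cycCum (j ↦ h j + h (j - 1)) b z = h z + h b`. [folklore] -/
private theorem tec_cycCum_telescope (hL : 1 < L) (h : ZMod L → ZMod 2) (b z : ZMod L) :
    cycCum (fun j => h j + h (j - 1)) b z = h z + h b := by
  have key : ∀ n : ℕ, n < L → cycCum (fun j => h j + h (j - 1)) b (b + n) = h (b + n) + h b := by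
    intro n
    induction n with
    | zero => intro _; rw [Nat.cast_zero, add_zero, tec_cycCum_self, tec_z2_add_self]
    | succ n ih =>
      intro hn
      have hne : b + (n : ZMod L) + 1 ≠ b := by
        intro h0
        have h1 : ((n + 1 : ℕ) : ZMod L) = 0 := by
          have := congrArg (· - b) h0
          simpa [Nat.cast_succ, add_assoc] using this
        exact Nat.succ_ne_zero n (tec_natCast_eq_zero hn h1)
      rw [Nat.cast_succ, ← add_assoc, tec_cycCum_add_one hL _ hne, ih (Nat.lt_of_succ_lt hn),
        add_sub_cancel_right]
      generalize h (b + ↑n + 1) = p; generalize h (b + ↑n) = q; generalize h b = r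
      revert p q r; decide
  rw [tec_eq_base_add_val b z]
  exact key _ (ZMod.val_lt _)

/-- The full circle: `cycCum g b (b - 1) + g b = Σ_z g z`. [folklore] -/
private theorem tec_cycCum_full (hL : 1 < L) (g : ZMod L → ZMod 2) (b : ZMod L) :
    cycCum g b (b - 1) + g b = ∑ z : ZMod L, g z := by
  haveI : Fact (1 < L) := ⟨hL⟩
  have hval : (b - 1 - b).val = L - 1 := by
    rw [show b - 1 - b = (-1 : ZMod L) by ring, ZMod.neg_val, if_neg one_ne_zero, ZMod.val_one]
  have hL1 : L - 1 + 1 = L := Nat.sub_add_cancel hL.le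
  rw [cycCum, hval]
  rw [show g b = g (b + ((0 : ℕ) : ZMod L)) by rw [Nat.cast_zero, add_zero]]
  rw [← sum_range_succ' (fun t => g (b + (t : ℕ))), hL1]
  -- reindex `range L → ZMod L`, `t ↦ b + t`
  refine sum_nbij' (fun t => b + (t : ZMod L)) (fun z => (z - b).val) (fun t _ => mem_univ _)
    (fun z _ => mem_range.2 (ZMod.val_lt _)) (fun t ht => ?_) (fun z _ => ?_) (fun t _ => rfl)
  · rw [add_sub_cancel_left, ZMod.val_natCast, Nat.mod_eq_of_lt (mem_range.1 ht)]
  · rw [ZMod.natCast_zmod_val, add_sub_cancel]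

end ZModAux

/-! ### Sites of the 2-torus: coordinates and unit steps -/

section Sites

variable (L : ℕ)

/-- The site with coordinates `(j, r)` (column `j`, row `r`). [cite: FriedliVelenik2017, §3.1] -/
def siteMk (j r : ZMod L) : TorusSite 2 L := ![j, r]

/-- First coordinate of `siteMk`. [cite: FriedliVelenik2017, §3.1] -/
@[simp] theorem siteMk_apply_zero (j r : ZMod L) : siteMk L j r 0 = j := rfl

/-- Second coordinate of `siteMk`. [cite: FriedliVelenik2017, §3.1] -/
@[simp] theorem siteMk_apply_one (j r : ZMod L) : siteMk L j r 1 = r := rfl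

/-- Every site is `siteMk` of its coordinates. [cite: FriedliVelenik2017, §3.1] -/
theorem siteMk_eta (x : TorusSite 2 L) : siteMk L (x 0) (x 1) = x := by
  ext i; fin_cases i <;> rfl

variable {L}

/-- Coordinates after a unit step in direction `0`. [cite: FriedliVelenik2017, §3.1] -/
@[simp] theorem add_single_zero_apply_zero (x : TorusSite 2 L) :
    (x + Pi.single 0 1 : TorusSite 2 L) 0 = x 0 + 1 := by simp
/-- Coordinates after a unit step in direction `0`. [cite: FriedliVelenik2017, §3.1] -/
@[simp] theorem add_single_zero_apply_one (x : TorusSite 2 L) :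
    (x + Pi.single 0 1 : TorusSite 2 L) 1 = x 1 := by simp
/-- Coordinates after a unit step in direction `1`. [cite: FriedliVelenik2017, §3.1] -/
@[simp] theorem add_single_one_apply_zero (x : TorusSite 2 L) :
    (x + Pi.single 1 1 : TorusSite 2 L) 0 = x 0 := by simp
/-- Coordinates after a unit step in direction `1`. [cite: FriedliVelenik2017, §3.1] -/
@[simp] theorem add_single_one_apply_one (x : TorusSite 2 L) :
    (x + Pi.single 1 1 : TorusSite 2 L) 1 = x 1 + 1 := by simp
/-- Coordinates after a unit step back in direction `0`. [cite: FriedliVelenik2017, §3.1] -/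
@[simp] theorem sub_single_zero_apply_zero (x : TorusSite 2 L) :
    (x - Pi.single 0 1 : TorusSite 2 L) 0 = x 0 - 1 := by simp
/-- Coordinates after a unit step back in direction `0`. [cite: FriedliVelenik2017, §3.1] -/
@[simp] theorem sub_single_zero_apply_one (x : TorusSite 2 L) :
    (x - Pi.single 0 1 : TorusSite 2 L) 1 = x 1 := by simp
/-- Coordinates after a unit step back in direction `1`. [cite: FriedliVelenik2017, §3.1] -/
@[simp] theorem sub_single_one_apply_zero (x : TorusSite 2 L) :
    (x - Pi.single 1 1 : TorusSite 2 L) 0 = x 0 := by simp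
/-- Coordinates after a unit step back in direction `1`. [cite: FriedliVelenik2017, §3.1] -/
@[simp] theorem sub_single_one_apply_one (x : TorusSite 2 L) :
    (x - Pi.single 1 1 : TorusSite 2 L) 1 = x 1 - 1 := by simp

/-- `x - e₀` in coordinates. [cite: FriedliVelenik2017, §3.1] -/
theorem sub_single_zero_eq (x : TorusSite 2 L) : x - Pi.single 0 1 = siteMk L (x 0 - 1) (x 1) := by
  ext i; fin_cases i <;> simp
/-- `x - e₁` in coordinates. [cite: FriedliVelenik2017, §3.1] -/
theorem sub_single_one_eq (x : TorusSite 2 L) : x - Pi.single 1 1 = siteMk L (x 0) (x 1 - 1) := by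
  ext i; fin_cases i <;> simp
/-- `x + e₀` in coordinates. [cite: FriedliVelenik2017, §3.1] -/
theorem add_single_zero_eq (x : TorusSite 2 L) : x + Pi.single 0 1 = siteMk L (x 0 + 1) (x 1) := by
  ext i; fin_cases i <;> simp
/-- `x + e₁` in coordinates. [cite: FriedliVelenik2017, §3.1] -/
theorem add_single_one_eq (x : TorusSite 2 L) : x + Pi.single 1 1 = siteMk L (x 0) (x 1 + 1) := by
  ext i; fin_cases i <;> simp
/-- `siteMk j r - e₀`. [cite: FriedliVelenik2017, §3.1] -/
theorem siteMk_sub_single_zero (j r : ZMod L) :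
    siteMk L j r - Pi.single 0 1 = siteMk L (j - 1) r := by
  rw [sub_single_zero_eq]; rfl
/-- `siteMk j r - e₁`. [cite: FriedliVelenik2017, §3.1] -/
theorem siteMk_sub_single_one (j r : ZMod L) :
    siteMk L j r - Pi.single 1 1 = siteMk L j (r - 1) := by
  rw [sub_single_one_eq]; rfl

end Sites

/-! ### `𝔽₂` edge chains, degrees, elementary chains -/

section Chains

variable (L : ℕ)

/-- An `𝔽₂` edge chain of the 2-torus: the coefficient `f x k` of the edge `{x, x + e_k}`.
[cite: Timar2012, §1] -/
abbrev TorusChain : Type := TorusSite 2 L → Fin 2 → ZMod 2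

/-- The mod-2 degree of a chain at a site: the coefficients of the four edges `{x, x ± e_k}` at `x`.
[cite: Timar2012, §1] -/
def chainDeg (f : TorusChain L) (x : TorusSite 2 L) : ZMod 2 :=
  ∑ k : Fin 2, (f x k + f (x - Pi.single k 1) k)

/-- The chain of the single edge `{z, z + e_k}`. [cite: Timar2012, §1] -/
def singleChain (z : TorusSite 2 L) (k : Fin 2) : TorusChain L :=
  fun x k' => if x = z ∧ k' = k then 1 else 0

/-- The plaquette (4-cycle) with lower-left corner `y`: edges `{y, y+e₀}`, `{y+e₁, y+e₁+e₀}`,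
`{y, y+e₁}`, `{y+e₀, y+e₀+e₁}`. [cite: Timar2012, §1] -/
def plaqChain (y : TorusSite 2 L) : TorusChain L :=
  singleChain L y 0 + singleChain L (y + Pi.single 1 1) 0 +
    (singleChain L y 1 + singleChain L (y + Pi.single 0 1) 1)

/-- The keys of the four edges of the plaquette at `y`. [cite: Timar2012, §1] -/
def plaqKeys (y : TorusSite 2 L) : Finset (TorusSite 2 L × Fin 2) :=
  {(y, 0), (y + Pi.single 1 1, 0), (y, 1), (y + Pi.single 0 1, 1)}

/-- The horizontal fundamental cycle through row `r`: all edges `{x, x + e₀}` with `x₁ = r`.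
[cite: FrohlichLieb1978, Thm. 1.1] -/
def rowChain (r : ZMod L) : TorusChain L := fun x k => if k = 0 ∧ x 1 = r then 1 else 0

/-- The vertical fundamental cycle through column `c`: all edges `{x, x + e₁}` with `x₀ = c`.
[cite: FrohlichLieb1978, Thm. 1.1] -/
def colChain (c : ZMod L) : TorusChain L := fun x k => if k = 1 ∧ x 0 = c then 1 else 0

/-- The span of the plaquettes with coefficients `a`: the edge `{x, x+e₀}` lies on the plaquettes
at `x` and `x - e₁`, the edge `{x, x+e₁}` on those at `x` and `x - e₀`. [cite: Timar2012, §1] -/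
def plaqSpan (a : TorusSite 2 L → ZMod 2) : TorusChain L :=
  fun x k => if k = 0 then a x + a (x - Pi.single 1 1) else a x + a (x - Pi.single 0 1)

/-- The `𝔽₂` pairing of a chain with a finite set of edge keys: `Σ_{e ∈ Γ} f e`.
[cite: Timar2012, Lemma 1] -/
def pairKeys (f : TorusChain L) (Γ : Finset (TorusSite 2 L × Fin 2)) : ZMod 2 :=
  ∑ e ∈ Γ, f e.1 e.2

variable {L}

/-- Degree is additive. [cite: Timar2012, §1] -/
theorem chainDeg_add (f g : TorusChain L) (x : TorusSite 2 L) :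
    chainDeg L (f + g) x = chainDeg L f x + chainDeg L g x := by
  simp only [chainDeg, Pi.add_apply, Fin.sum_univ_two]; ring

/-- Degree of a single edge: `1` at its two endpoints (mod 2). [cite: Timar2012, §1] -/
theorem chainDeg_singleChain [NeZero L] (z : TorusSite 2 L) (k : Fin 2) (x : TorusSite 2 L) :
    chainDeg L (singleChain L z k) x =
      (if x = z then 1 else 0) + (if x = z + Pi.single k 1 then 1 else 0) := by
  have e2 : ∀ k' : Fin 2, (x - Pi.single k' 1 = z) ↔ x = z + Pi.single k' 1 := fun k' =>
    sub_eq_iff_eq_add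
  simp only [chainDeg, singleChain, Fin.sum_univ_two, e2]
  fin_cases k <;> simp

/-- The pairing is additive in the chain. [cite: Timar2012, Lemma 1] -/
theorem pairKeys_add (f g : TorusChain L) (Γ : Finset (TorusSite 2 L × Fin 2)) :
    pairKeys L (f + g) Γ = pairKeys L f Γ + pairKeys L g Γ := by
  simp only [pairKeys, Pi.add_apply, sum_add_distrib]

/-- The pairing of a finite sum of chains. [cite: Timar2012, Lemma 1] -/
theorem pairKeys_sum {ι : Type*} (s : Finset ι) (f : ι → TorusChain L)
    (Γ : Finset (TorusSite 2 L × Fin 2)) :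
    pairKeys L (∑ i ∈ s, f i) Γ = ∑ i ∈ s, pairKeys L (f i) Γ := by
  simp only [pairKeys, Finset.sum_apply]
  rw [Finset.sum_comm]

/-- The pairing of a scalar multiple. [cite: Timar2012, Lemma 1] -/
theorem pairKeys_mul (c : ZMod 2) (f : TorusChain L) (Γ : Finset (TorusSite 2 L × Fin 2)) :
    pairKeys L (fun x k => c * f x k) Γ = c * pairKeys L f Γ := by
  simp only [pairKeys, mul_sum]

/-- The pairing of a single edge: the indicator of its key. [cite: Timar2012, Lemma 1] -/
theorem pairKeys_singleChain (z : TorusSite 2 L) (k : Fin 2) (Γ : Finset (TorusSite 2 L × Fin 2)) :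
    pairKeys L (singleChain L z k) Γ = if (z, k) ∈ Γ then 1 else 0 := by
  simp only [pairKeys, singleChain]
  have : ∀ e : TorusSite 2 L × Fin 2, (e.1 = z ∧ e.2 = k) ↔ e = (z, k) := fun e => by
    rw [Prod.ext_iff]
  simp_rw [this]
  rw [sum_ite_eq']

/-- A chain vanishing on `Γ` pairs to zero with it. [cite: Timar2012, Lemma 1] -/
theorem pairKeys_eq_zero_of_forall {f : TorusChain L} {Γ : Finset (TorusSite 2 L × Fin 2)}
    (h : ∀ e ∈ Γ, f e.1 e.2 = 0) : pairKeys L f Γ = 0 :=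
  sum_eq_zero h

/-- Restricting the pairing to where the chain lives. [cite: Timar2012, Lemma 1] -/
theorem pairKeys_eq_of_subset {f : TorusChain L} {Γ₁ Γ : Finset (TorusSite 2 L × Fin 2)}
    (hsub : Γ₁ ⊆ Γ) (h : ∀ e ∈ Γ, e ∉ Γ₁ → f e.1 e.2 = 0) : pairKeys L f Γ₁ = pairKeys L f Γ :=
  sum_subset hsub h

/-- A nonzero coefficient of a plaquette chain sits on one of its four edges.
[cite: Timar2012, §1] -/
theorem mem_plaqKeys_of_ne_zero {y x : TorusSite 2 L} {k : Fin 2} (h : plaqChain L y x k ≠ 0) :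
    (x, k) ∈ plaqKeys L y := by
  by_contra hne
  simp only [plaqKeys, mem_insert, mem_singleton, Prod.mk.injEq, not_or] at hne
  obtain ⟨h1, h2, h3, h4⟩ := hne
  apply h
  simp only [plaqChain, Pi.add_apply, singleChain, if_neg h1, if_neg h2, if_neg h3, if_neg h4,
    add_zero]

/-- `Σ_y a_y · [x = y, k = k₀] = [k = k₀] a_x`. [folklore] -/
private theorem tec_sum_mul_ite [NeZero L] (a : TorusSite 2 L → ZMod 2) (x : TorusSite 2 L)
    (k k₀ : Fin 2) :
    (∑ y, a y * (if x = y ∧ k = k₀ then (1 : ZMod 2) else 0)) = if k = k₀ then a x else 0 := by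
  by_cases hk : k = k₀
  · simp only [hk, and_true, mul_ite, mul_one, mul_zero, if_true]
    simp_rw [show ∀ y, (x = y) ↔ (y = x) from fun y => eq_comm]
    rw [sum_ite_eq', if_pos (mem_univ _)]
  · simp [hk]

/-- `Σ_y a_y · [x = y + v, k = k₀] = [k = k₀] a_{x-v}`. [folklore] -/
private theorem tec_sum_mul_ite_add [NeZero L] (a : TorusSite 2 L → ZMod 2) (x v : TorusSite 2 L)
    (k k₀ : Fin 2) :
    (∑ y, a y * (if x = y + v ∧ k = k₀ then (1 : ZMod 2) else 0)) =
      if k = k₀ then a (x - v) else 0 := by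
  by_cases hk : k = k₀
  · simp only [hk, and_true, mul_ite, mul_one, mul_zero, if_true]
    simp_rw [show ∀ y, (x = y + v) ↔ (y = x - v) from fun y => by rw [eq_sub_iff_add_eq, eq_comm]]
    rw [sum_ite_eq', if_pos (mem_univ _)]
  · simp [hk]

/-- `plaqSpan a` is the `𝔽₂`-combination `Σ_y a_y · plaq_y`. [cite: Timar2012, §1] -/
theorem plaqSpan_eq_sum [NeZero L] (a : TorusSite 2 L → ZMod 2) (x : TorusSite 2 L) (k : Fin 2) :
    plaqSpan L a x k = ∑ y, a y * plaqChain L y x k := by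
  simp only [plaqChain, Pi.add_apply, singleChain, mul_add, sum_add_distrib, tec_sum_mul_ite,
    tec_sum_mul_ite_add, plaqSpan]
  fin_cases k
  · simp
  · simp

/-- Pairing with the plaquette span reduces to the plaquettes. [cite: Timar2012, Lemma 1] -/
theorem pairKeys_plaqSpan [NeZero L] (a : TorusSite 2 L → ZMod 2) (Γ : Finset (TorusSite 2 L × Fin 2)) :
    pairKeys L (plaqSpan L a) Γ = ∑ y, a y * pairKeys L (plaqChain L y) Γ := by
  simp only [pairKeys, plaqSpan_eq_sum, mul_sum]
  rw [sum_comm]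

end Chains

/-! ### Cuts: the edge boundary of a site set, and the pairing of cycles with cuts -/

section Cuts

variable (L : ℕ) [NeZero L]

/-- The `𝔽₂`-valued indicator of a decidable proposition. [folklore] -/
def indZ2 (p : Prop) [Decidable p] : ZMod 2 := if p then 1 else 0

/-- **The cut of a site set `A`**: the keys `(x, k)` of the edges `{x, x + e_k}` with exactly one
endpoint in `A` (the contour `γ = ∂A` as a set of edges). [cite: FrohlichLieb1978, §I.C Definition 1]
[cite: FriedliVelenik2017, §3.7.2] -/
def cutKeys (A : Finset (TorusSite 2 L)) : Finset (TorusSite 2 L × Fin 2) :=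
  univ.filter fun e => ¬(e.1 ∈ A ↔ e.1 + Pi.single e.2 1 ∈ A)

variable {L}

/-- Membership in the cut: the endpoints lie on different sides.
[cite: FrohlichLieb1978, §I.C Definition 1] -/
theorem mem_cutKeys {A : Finset (TorusSite 2 L)} {e : TorusSite 2 L × Fin 2} :
    e ∈ cutKeys L A ↔ ¬(e.1 ∈ A ↔ e.1 + Pi.single e.2 1 ∈ A) := by
  simp [cutKeys]

/-- The cut of the complement is the same cut. [cite: FrohlichLieb1978, §I.C Definition 1] -/
theorem cutKeys_compl (A : Finset (TorusSite 2 L)) : cutKeys L Aᶜ = cutKeys L A := by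
  ext e
  simp only [mem_cutKeys, mem_compl]
  tauto

/-- The indicator of "different sides" is the sum of the indicators in `𝔽₂`. [folklore] -/
private theorem tec_ite_not_iff (p q : Prop) [Decidable p] [Decidable q] :
    (if ¬(p ↔ q) then (1 : ZMod 2) else 0) = indZ2 p + indZ2 q := by
  unfold indZ2
  by_cases hp : p <;> by_cases hq : q
  · rw [if_neg (by tauto), if_pos hp, if_pos hq]; decide
  · rw [if_pos (by tauto), if_pos hp, if_neg hq]; decide
  · rw [if_pos (by tauto), if_neg hp, if_pos hq]; decide
  · rw [if_neg (by tauto), if_neg hp, if_neg hq]; decide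

/-- The cut indicator of a key is `[z ∈ A] + [z + e_k ∈ A]` in `𝔽₂`.
[cite: FrohlichLieb1978, §I.C Definition 1] -/
theorem ite_mem_cutKeys (A : Finset (TorusSite 2 L)) (z : TorusSite 2 L) (k : Fin 2) :
    (if (z, k) ∈ cutKeys L A then (1 : ZMod 2) else 0) =
      indZ2 (z ∈ A) + indZ2 (z + Pi.single k 1 ∈ A) := by
  rw [← tec_ite_not_iff]
  by_cases h : (z, k) ∈ cutKeys L A
  · rw [if_pos h, if_pos (mem_cutKeys.1 h)]
  · rw [if_neg h, if_neg (fun h' => h (mem_cutKeys.2 h'))]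

/-- A single edge pairs with a cut to `[z ∈ A] + [z + e_k ∈ A]`. [cite: Timar2012, Lemma 1] -/
theorem pairKeys_singleChain_cutKeys (z : TorusSite 2 L) (k : Fin 2) (A : Finset (TorusSite 2 L)) :
    pairKeys L (singleChain L z k) (cutKeys L A) = indZ2 (z ∈ A) + indZ2 (z + Pi.single k 1 ∈ A) := by
  rw [pairKeys_singleChain, ite_mem_cutKeys]

/-- Four indicators combined as around a plaquette cancel in `𝔽₂`. [folklore] -/
private theorem tec_plaq_cancel : ∀ P Q R S : ZMod 2, P + Q + (R + S) + (P + R + (Q + S)) = 0 := by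
  decide

/-- **A plaquette crosses every cut an even number of times**: `⟨plaq_y, ∂A⟩ = 0` in `𝔽₂`.
[cite: Timar2012, Lemma 1] -/
theorem pairKeys_plaqChain_cutKeys (y : TorusSite 2 L) (A : Finset (TorusSite 2 L)) :
    pairKeys L (plaqChain L y) (cutKeys L A) = 0 := by
  rw [plaqChain, pairKeys_add, pairKeys_add, pairKeys_add, pairKeys_singleChain_cutKeys,
    pairKeys_singleChain_cutKeys, pairKeys_singleChain_cutKeys, pairKeys_singleChain_cutKeys,
    show y + Pi.single (1 : Fin 2) (1 : ZMod L) + Pi.single 0 1 = y + Pi.single 0 1 + Pi.single 1 1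
      from add_right_comm _ _ _]
  exact tec_plaq_cancel _ _ _ _

/-- **A fundamental row cycle crosses every cut an even number of times.**
[cite: Timar2012, Lemma 1] -/
theorem pairKeys_rowChain_cutKeys (r : ZMod L) (A : Finset (TorusSite 2 L)) :
    pairKeys L (rowChain L r) (cutKeys L A) = 0 := by
  have h1 : pairKeys L (rowChain L r) (cutKeys L A) =
      ∑ x : TorusSite 2 L, ((if x 1 = r then indZ2 (x ∈ A) else 0) +
        (if x 1 = r then indZ2 (x + Pi.single 0 1 ∈ A) else 0)) := by
    unfold pairKeys cutKeys
    rw [sum_filter, Fintype.sum_prod_type]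
    refine sum_congr rfl fun x _ => ?_
    rw [Fin.sum_univ_two]
    simp only [rowChain, Fin.isValue, true_and, one_ne_zero, false_and, if_false, ite_self, add_zero]
    by_cases hx : x 1 = r
    · simp only [hx, if_true, tec_ite_not_iff]
    · simp only [hx, if_false, ite_self, add_zero]
  have h2 : ∑ x : TorusSite 2 L, (if x 1 = r then indZ2 (x + Pi.single 0 1 ∈ A) else 0) =
      ∑ x : TorusSite 2 L, (if x 1 = r then indZ2 (x ∈ A) else 0) :=
    Fintype.sum_equiv (Equiv.addRight (Pi.single 0 1)) _ _ fun x => by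
      simp only [Equiv.coe_addRight, add_single_zero_apply_one]
      congr 1
  rw [h1, sum_add_distrib, h2, tec_z2_add_self]

/-- **A fundamental column cycle crosses every cut an even number of times.**
[cite: Timar2012, Lemma 1] -/
theorem pairKeys_colChain_cutKeys (c : ZMod L) (A : Finset (TorusSite 2 L)) :
    pairKeys L (colChain L c) (cutKeys L A) = 0 := by
  have h1 : pairKeys L (colChain L c) (cutKeys L A) =
      ∑ x : TorusSite 2 L, ((if x 0 = c then indZ2 (x ∈ A) else 0) +
        (if x 0 = c then indZ2 (x + Pi.single 1 1 ∈ A) else 0)) := by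
    unfold pairKeys cutKeys
    rw [sum_filter, Fintype.sum_prod_type]
    refine sum_congr rfl fun x _ => ?_
    rw [Fin.sum_univ_two]
    simp only [colChain, Fin.isValue, zero_ne_one, false_and, if_false, ite_self, zero_add, true_and]
    by_cases hx : x 0 = c
    · simp only [hx, if_true, tec_ite_not_iff]
    · simp only [hx, if_false, ite_self, add_zero]
  have h2 : ∑ x : TorusSite 2 L, (if x 0 = c then indZ2 (x + Pi.single 1 1 ∈ A) else 0) =
      ∑ x : TorusSite 2 L, (if x 0 = c then indZ2 (x ∈ A) else 0) :=
    Fintype.sum_equiv (Equiv.addRight (Pi.single 1 1)) _ _ fun x => by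
      simp only [Equiv.coe_addRight, add_single_one_apply_zero]
      congr 1
  rw [h1, sum_add_distrib, h2, tec_z2_add_self]

omit [NeZero L] in
/-- **Chains that do not cross**: if every edge in the support of `χ` has its endpoints on the same
side of a predicate `p`, and every key of `Γ` has its endpoints on different sides, then
`⟨χ, Γ⟩ = 0`. [cite: Timar2012, Lemma 1] -/
theorem pairKeys_eq_zero_of_sameSide {p : TorusSite 2 L → Prop} {χ : TorusChain L}
    (hχ : ∀ x k, χ x k ≠ 0 → (p x ↔ p (x + Pi.single k 1)))
    {Γ : Finset (TorusSite 2 L × Fin 2)} (hΓ : ∀ e ∈ Γ, ¬(p e.1 ↔ p (e.1 + Pi.single e.2 1))) :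
    pairKeys L χ Γ = 0 := by
  refine pairKeys_eq_zero_of_forall fun e he => ?_
  by_contra hne
  exact hΓ e he (hχ e.1 e.2 hne)

/-- Keys of a cut have their endpoints on different sides of `A`.
[cite: FrohlichLieb1978, §I.C Definition 1] -/
theorem not_iff_of_mem_cutKeys {A : Finset (TorusSite 2 L)} {e : TorusSite 2 L × Fin 2}
    (he : e ∈ cutKeys L A) : ¬(e.1 ∈ A ↔ e.1 + Pi.single e.2 1 ∈ A) :=
  mem_cutKeys.1 he

end Cuts

/-! ### Generation of the cycle space by plaquettes and two fundamental cycles -/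

section Generation

variable {L : ℕ} [NeZero L]

/-- Degree condition rearranged in `𝔽₂`. [folklore] -/
private theorem tec_z2_of_deg : ∀ p q u v : ZMod 2, p + q + (u + v) = 0 → u + v = p + q := by decide

/-- Case algebra, horizontal key off the base row. [folklore] -/
private theorem tec_alg_h_off : ∀ F H C C' S S' : ZMod 2,
    S + S' = F + H → C = C' + H → F = C + S + (C' + S') := by decide

/-- Case algebra, horizontal key on the base row. [folklore] -/
private theorem tec_alg_h_on : ∀ F H T S S' C' : ZMod 2,
    S + S' = F + H → C' + H = T → F = 0 + S + (C' + S') + T := by decide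

/-- Case algebra, vertical key off the base column. [folklore] -/
private theorem tec_alg_v_off : ∀ F C S S' : ZMod 2, S = S' + F → F = C + S + (C + S') := by decide

/-- Case algebra, vertical key on the base column. [folklore] -/
private theorem tec_alg_v_on : ∀ F C S' E : ZMod 2, S' + F = E → F = C + 0 + (C + S') + E := by decide

/-- **The cycle space of the torus graph is generated by the plaquettes and two fundamental
cycles.** On `(ℤ/Lℤ)²`, `L ≥ 2`: every `𝔽₂` edge chain `f` with all degrees even is
`f = plaqSpan a + ε₀ · rowChain r₀ + ε₁ · colChain c₀` for every prescribed row `r₀` and column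
`c₀`, with explicit `a` (cyclic cumulative sums of `f`), `ε₀ = Σ_s f((c₀,s),0)`,
`ε₁ = Σ_j f((j,r₀),1)` (first homology of the torus; the graph-theoretic form used in Timár's
cutset lemma). [cite: Timar2012, Lemma 1] [cite: FrohlichLieb1978, Thm. 1.1] -/
theorem exists_eq_plaqSpan_add (hL : 1 < L) (f : TorusChain L) (hf : ∀ x, chainDeg L f x = 0)
    (r₀ c₀ : ZMod L) :
    ∃ (a : TorusSite 2 L → ZMod 2) (ε₀ ε₁ : ZMod 2), ∀ x k,
      f x k = plaqSpan L a x k + ε₀ * rowChain L r₀ x k + ε₁ * colChain L c₀ x k := by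
  -- coordinates: `g1 r j` = vertical key at `(j, r)`, `h0 r j` = horizontal key at `(j, r)`
  set g1 : ZMod L → ZMod L → ZMod 2 := fun r j => f (siteMk L j r) 1 with hg1
  set h0 : ZMod L → ZMod L → ZMod 2 := fun r j => f (siteMk L j r) 0 with hh0
  set hc : ZMod L → ZMod 2 := fun s => f (siteMk L c₀ s) 0 with hhc
  set V : ZMod L → ZMod 2 := fun r => ∑ j, g1 r j with hV
  -- the degree condition in coordinates
  have hdeg : ∀ j r, h0 r j + h0 r (j - 1) + (g1 r j + g1 (r - 1) j) = 0 := by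
    intro j r
    have := hf (siteMk L j r)
    rw [chainDeg, Fin.sum_univ_two, siteMk_sub_single_zero, siteMk_sub_single_one] at this
    exact this
  -- the row sums of vertical keys are all equal
  have hVstep : ∀ r, V r = V (r - 1) := by
    intro r
    have hsum : ∑ j, (h0 r j + h0 r (j - 1) + (g1 r j + g1 (r - 1) j)) = 0 :=
      sum_eq_zero fun j _ => hdeg j r
    rw [sum_add_distrib, sum_add_distrib, sum_add_distrib] at hsum
    have hre : ∑ j, h0 r (j - 1) = ∑ j, h0 r j :=
      Fintype.sum_equiv (Equiv.subRight 1) _ _ fun _ => rfl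
    rw [hre, tec_z2_add_self, zero_add] at hsum
    exact (tec_z2_add_eq_zero_iff _ _).1 hsum
  have hVconst : ∀ r, V r = V r₀ := by
    have key : ∀ n : ℕ, V (r₀ + n) = V r₀ := by
      intro n
      induction n with
      | zero => rw [Nat.cast_zero, add_zero]
      | succ n ih => rw [Nat.cast_succ, ← add_assoc, hVstep, add_sub_cancel_right, ih]
    intro r
    rw [tec_eq_base_add_val r₀ r]
    exact key _
  refine ⟨fun x => cycCum hc r₀ (x 1) + cycCum (g1 (x 1)) c₀ (x 0), ∑ s, hc s, V r₀, ?_⟩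
  -- horizontal keys
  have hk0 : ∀ x : TorusSite 2 L, f x 0 =
      (cycCum hc r₀ (x 1) + cycCum (g1 (x 1)) c₀ (x 0) +
        (cycCum hc r₀ ((x - Pi.single 1 1 : TorusSite 2 L) 1) +
          cycCum (g1 ((x - Pi.single 1 1 : TorusSite 2 L) 1)) c₀ ((x - Pi.single 1 1 : TorusSite 2 L) 0))) +
      (∑ s, hc s) * rowChain L r₀ x 0 + V r₀ * colChain L c₀ x 0 := by
    intro x
    simp only [sub_single_one_apply_zero, sub_single_one_apply_one, rowChain, colChain, Fin.isValue,
      true_and, zero_ne_one, false_and, if_false, mul_zero, add_zero]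
    -- the two cumulative sums of vertical keys telescope to `f x 0 + hc (x 1)`
    have hS : cycCum (g1 (x 1)) c₀ (x 0) + cycCum (g1 (x 1 - 1)) c₀ (x 0) = f x 0 + hc (x 1) := by
      rw [← tec_cycCum_add]
      have hfun : (g1 (x 1) + g1 (x 1 - 1)) = fun j => h0 (x 1) j + h0 (x 1) (j - 1) := by
        funext j
        exact tec_z2_of_deg _ _ _ _ (hdeg j (x 1))
      rw [hfun, tec_cycCum_telescope hL]
      simp only [hh0, hhc, siteMk_eta]
    by_cases hx : x 1 = r₀
    · rw [if_pos hx, mul_one]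
      have hc1 : cycCum hc r₀ (x 1) = 0 := by rw [hx, tec_cycCum_self]
      have hc2 : cycCum hc r₀ (x 1 - 1) + hc (x 1) = ∑ s, hc s := by rw [hx]; exact tec_cycCum_full hL hc r₀
      rw [hc1]
      exact tec_alg_h_on _ _ _ _ _ _ hS hc2
    · rw [if_neg hx, mul_zero, add_zero]
      have hc2 : cycCum hc r₀ (x 1) = cycCum hc r₀ (x 1 - 1) + hc (x 1) := by
        have := tec_cycCum_add_one hL hc (b := r₀) (z := x 1 - 1) (by rwa [sub_add_cancel])
        rwa [sub_add_cancel] at this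
      exact tec_alg_h_off _ _ _ _ _ _ hS hc2
  -- vertical keys
  have hk1 : ∀ x : TorusSite 2 L, f x 1 =
      (cycCum hc r₀ (x 1) + cycCum (g1 (x 1)) c₀ (x 0) +
        (cycCum hc r₀ ((x - Pi.single 0 1 : TorusSite 2 L) 1) +
          cycCum (g1 ((x - Pi.single 0 1 : TorusSite 2 L) 1)) c₀ ((x - Pi.single 0 1 : TorusSite 2 L) 0))) +
      (∑ s, hc s) * rowChain L r₀ x 1 + V r₀ * colChain L c₀ x 1 := by
    intro x
    simp only [sub_single_zero_apply_zero, sub_single_zero_apply_one, rowChain, colChain, Fin.isValue,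
      true_and, one_ne_zero, false_and, if_false, mul_zero, add_zero]
    by_cases hx : x 0 = c₀
    · rw [if_pos hx, mul_one, hx, tec_cycCum_self]
      have hS : cycCum (g1 (x 1)) c₀ (c₀ - 1) + f x 1 = V r₀ := by
        have hfx : f x 1 = g1 (x 1) c₀ := by
          rw [← hx]
          show f x 1 = f (siteMk L (x 0) (x 1)) 1
          rw [siteMk_eta]
        rw [hfx, tec_cycCum_full hL (g1 (x 1)) c₀]
        exact hVconst (x 1)
      exact tec_alg_v_on _ _ _ _ hS
    · rw [if_neg hx, mul_zero, add_zero]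
      have hS : cycCum (g1 (x 1)) c₀ (x 0) = cycCum (g1 (x 1)) c₀ (x 0 - 1) + f x 1 := by
        have := tec_cycCum_add_one hL (g1 (x 1)) (b := c₀) (z := x 0 - 1) (by rwa [sub_add_cancel])
        rw [sub_add_cancel] at this
        rw [this]
        simp only [hg1, siteMk_eta]
      exact tec_alg_v_off _ _ _ _ hS
  intro x k
  fin_cases k
  · simpa only [plaqSpan, Fin.zero_eta, Fin.isValue, if_true] using hk0 x
  · simpa only [plaqSpan, Fin.mk_one, Fin.isValue, one_ne_zero, if_false] using hk1 x

end Generation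

end Literature.Probability.LatticeModels

end
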